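import Mathlib.LinearAlgebra.Matrix.Trace
import Mathlib.Analysis.Complex.Basic
import Mathlib.RingTheory.MvPolynomial.Homogeneous
import Literature.Computability.AlgebraicComplexity.DeterminantalComplexity
import HarnessLib

/-!
# From determinantal expressions to traces of matrix powers (Ikenmeyer–Landsberg 2017, Thm. 4.1)

Topic `Literature/Computability/AlgebraicComplexity`; namespace
`Literature.Computability.AlgebraicComplexity`. Grounding file for the support item
`Summit.ValiantsHypothesis.ValiantsHypothesis.Theses.GeneratorObstructions.PerPowTraceQP`
(stmt-ValiantsHypothesis-11661: "VP ⇒ quasi-polynomial trace-power representations of the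
permanent"), which is the in-tree fact `isQPBounded_determinantalComplexity_of_isVPFamily`
(VP ⇒ `dc` quasi-polynomially bounded, PROVED: `…_holds`) composed with the printed polynomial
relation between determinantal complexity and the **homogeneous matrix powering complexity**
`hmpc(P) = min {n : P = tr(A^d), A an n × n matrix of linear forms}` (= `pc` of
Gesmundo–Ikenmeyer–Panova 2017, §2.2, the tree's `Literature.Barriers.ValiantsHypothesis.HasPowTraceRepr`,
here spelled out to keep the barrier catalogue out of the import cone), plus zero-padding.

## What is printed (arXiv:1610.00159, read pp. 4 and 7 of the materialised text)

Thm. 4.1: "The complexity measures rdc, dc, labpc, immc, abpc, himmc, and dlabpc are all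
polynomially related. More precisely, let `P` be any polynomial. Let `φ(m) := m³/3 − m/3 + 2` denote
the layered ABP size of the Mahajan–Vinay construction for `det_m`. Then • `dc(P) ≤ labpc(P) − 1` …
• `labpc(P) ≤ φ(dc(P))` … • `labpc(P) = immc(P) + 1`. If `P` is homogeneous, then
`dlabpc(P) = himmc(P) + 1`. • By definition `abpc(P) ≤ labpc(P) ≤ dlabpc(P)` … If `P` is homogeneous
of degree `d` then `dlabpc(P) ≤ (d+1)·abpc(P)`."
Rem. 4.5: "Another complexity measure is the homogeneous matrix powering complexity: If
`P = tr(A^m)`, then … `himmc(P) ≤ m · hmpc(P)`. Conversely, if `himmc(P) = n`, then `dlabpc(P) = n+1`,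
… Let `A` be the `n × n` adjacency matrix of `Γ'` … We conclude that `P = tr(A^m)` and thus
`hmpc(P) ≤ himmc(P)`."
Chaining: `hmpc(P) ≤ himmc(P) = dlabpc(P) − 1 ≤ (d+1)·abpc(P) − 1 ≤ (d+1)·labpc(P) − 1
≤ (d+1)·φ(dc(P)) − 1`, and `dc(P) ≤ s` whenever `P` has an affine determinantal expression of size
`s` (`φ` is increasing).

## Statement vendored (named fact, D-0014; nothing asserted)

`IkenmeyerLandsberg2017_powTrace_of_detRepr`: over `ℂ`, for a homogeneous `P` of degree `d ≥ 1`
in finitely many variables with an affine determinantal expression of size `s` (accepted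
`HasDetRepr P s`), there is an `N × N` matrix `A` of homogeneous linear forms with `tr(A^d) = P`
and `N + 1 ≤ (d + 1) · φ(s)`, `φ(s) = (s³ − s)/3 + 2` (exact in `ℕ`: `3 ∣ s³ − s`, `s³ ≥ s`).

## Not here

The intermediate models (ABPs, IMM) and the individual inequalities; the converse direction
`dc ≤ poly(hmpc)`; GIP17's "pc(per_m) ≤ 2^m − 1" (Grenet), which is the accepted `GIP2017_pc_le`.

## Sources

* C. Ikenmeyer, J. M. Landsberg, *On the complexity of the permanent in various computational
  models*, J. Pure Appl. Algebra 221 (2017) 2911–2927 = arXiv:1610.00159, Thm. 4.1, Rem. 4.5,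
  Def. 2.1–2.2. [IkenmeyerLandsberg2017]
* F. Gesmundo, C. Ikenmeyer, G. Panova, *Geometric complexity theory and matrix powering*,
  Diff. Geom. Appl. 55 (2017) = arXiv:1611.00827, §2.2 ("pc(per_m) and dc(per_m) are polynomially
  equivalent", citing Nisan 1991). [GesmundoIkenmeyerPanova2017]
* M. Mahajan, V. Vinay, *Determinant: combinatorics, algorithms, and complexity* (1997) (the
  layered ABP of size `φ(m)` for `det_m`). [MahajanVinay1997]
-/

namespace Literature.Computability.AlgebraicComplexity

/-- **Ikenmeyer–Landsberg 2017, Thm. 4.1 with Rem. 4.5 (chained):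
`hmpc(P) ≤ (d+1)·φ(dc(P)) − 1`.** For a homogeneous polynomial `P` of degree `d ≥ 1` over `ℂ` in
finitely many variables admitting an affine determinantal expression of size `s`
(`HasDetRepr P s`, so `dc(P) ≤ s`), there is a square matrix `A` of size `N` whose entries are
homogeneous linear forms with `tr(A^d) = P` (a homogeneous matrix-powering / power-trace
representation, Gesmundo–Ikenmeyer–Panova's `pc`), where `N + 1 ≤ (d+1)·φ(s)` and
`φ(s) = (s³ − s)/3 + 2` is the size of the Mahajan–Vinay layered ABP for `det_s` (the `ℕ`
expression is exact: `s ≤ s³` and `3 ∣ s³ − s`). Named fact (D-0014). Grounds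
`Summit.ValiantsHypothesis.ValiantsHypothesis.Theses.GeneratorObstructions.PerPowTraceQP` together
with the proved `isQPBounded_determinantalComplexity_of_isVPFamily_holds` and zero-padding.
[cite: IkenmeyerLandsberg2017, Thm. 4.1 and Rem. 4.5] -/
def IkenmeyerLandsberg2017_powTrace_of_detRepr : Prop :=
  ∀ {M : Type} [Fintype M] (P : MvPolynomial M ℂ) (d s : ℕ), 1 ≤ d → P.IsHomogeneous d →
    HasDetRepr P s →
      ∃ (N : ℕ) (A : Matrix (Fin N) (Fin N) (MvPolynomial M ℂ)),
        N + 1 ≤ (d + 1) * ((s ^ 3 - s) / 3 + 2) ∧ (∀ i j, (A i j).IsHomogeneous 1) ∧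
          (A ^ d).trace = P

end Literature.Computability.AlgebraicComplexity
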